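import Mathlib.Tactic.Ring
import Mathlib.Tactic.Linarith
import Mathlib.Tactic.LinearCombination
import Mathlib.Data.Real.Basic
import HarnessLib

/-!
# Conjecture N (hodge-weil ladder, GAPS G51b/G51c), format (5,3): THE DIVIDED-DIFFERENCE PRODUCT FORMULA for `Q₂`, `Q₄`

Prover 2, generation 15 (note `run/shared/lean/b2b/hodge-weil/b2b-hweil-pv2-g15/DIVIDED-DIFFERENCE-G15.md`), carrying out the lead of
pv2-g14 (`THREE-PHASE-G14.md`, ADDENDUM 2) in the kernel. Setting of `CONJECTURE-N.md` §1 in format (5,3), real charges, CENTRED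
coordinates: E-roots with positions `A₁..A₅` and charges `u₁..u₅`, F-roots with positions `B₁, B₂, B₃` and charges `v₁, v₂, v₃`,
centring `ΣA = ΣB` (hA), `Σu = Σv` (hC); purity sums `P1 = ΣA²u − ΣB²v`, `P2 = ΣAu² − ΣBv²`, `P4 = Σu³ − Σv³`;
`Q₂ = ½S_AS_u + S_Au² − 3S_{A²u²}`, `Q₄ = 3S_{u⁴} − (3/2)S_u²` (signed sums `S`), `G_λ = Q₂ + λQ₄`.
For an F-root `g` write `a_e = A_e − B_g`, `b_e = u_e − v_g` and `Π_g(y) := ∏_e (b_e + y·a_e)`. The (4,2) PRODUCT FORMULA of pv2-g13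
(`WeilClassTestProductFormula.lean`: `Q₄ = −12·[y⁰]Π_f + …`, `Q₂ = 2·[y²]Π_f + …`) becomes, in format (5,3), a formula in the FIRST DIVIDED
DIFFERENCE of `g ↦ Π_g(y)` over two of the three F-roots, written division-free by the Leibniz rule:
`M₁₂(y) := (Π₁(y) − Π₂(y)) / ((v₂ − v₁) + y(B₂ − B₁)) = Σ_e ∏_{e'<e} ((u_e' − v₁) + y(A_e' − B₁)) · ∏_{e'>e} ((u_e' − v₂) + y(A_e' − B₂))`
(a polynomial in `y`; `[y^r]M₁₂` written out below as sums of products).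
THEOREM (polynomial identities, centring only; multipliers from the THIRD F-root exactly as in format (4,2)):
`Q₄ = −12·[y⁰]M₁₂ + 4v₃·P4`, `Q₂ = 2·[y²]M₁₂ − 2v₃·P1 − 2B₃·P2`, `c₁ := 12Σεu³A − 6S_uS_{Au} = −12·[y¹]M₁₂ + 12v₃·P2 + 4B₃·P4`;
hence on the pure locus `G_λ = 2·([y²]M₁₂ − 6λ·[y⁰]M₁₂)` (`Glam_eq_dd12`). COMPANIONS: the pair `(1,3)` gives the same three
numbers up to purity sums — `[y⁰]M₁₂ − [y⁰]M₁₃ = ((v₃ − v₂)/3)·P4`, `[y¹]M₁₂ − [y¹]M₁₃ = (v₃ − v₂)·P2 + ((B₃ − B₂)/3)·P4`,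
`[y²]M₁₂ − [y²]M₁₃ = (v₃ − v₂)·P1 + (B₃ − B₂)·P2` — i.e. PURITY = 'the second divided difference of `g ↦ Π_g(y)` over the three F-roots
vanishes to order `y²`', and `Q₄/12 = (K₀(g) − K₀(h))/(v_g − v_h)` for every pair (the three points `(v_g, K₀(g))`, `K₀(g) = ∏_e(u_e − v_g)`,
are COLLINEAR on the pure locus). In symmetric-function language: `−Q₄/12 = e₄(L)`, `Q₂/2 = [y²]e₄(L(y))`, `P4/3 = e₃(L)` for the virtual
alphabet `L(y) = {u_e + yA_e} − {v_f + yB_f}`. Pure algebra (`ring` after eliminating `B₃, v₃` by centring); nothing here is a rung, a door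
edge or a cited fact; no statement of Markman's papers is used. New cell result ⇒ Summits/.
-/

set_option linter.dupNamespace false

namespace Summit.HodgeConjecture.HodgeConjecture.WeilClassTestFormatFiveThreeProductFormula

/-- DIVIDED-DIFFERENCE PRODUCT FORMULA for `Q₄` (format (5,3)), relative to the F-roots `1, 2`:
`Q₄ = −12·[y⁰]M₁₂ + 4·v₃·P4`, `[y⁰]M₁₂ = Σ_e ∏_{e'<e}(u_e' − v₁)·∏_{e'>e}(u_e' − v₂)` (centred charges). -/
theorem Q4_eq_dd12 (u₁ u₂ u₃ u₄ u₅ v₁ v₂ v₃ : ℝ)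
    (hC : u₁ + u₂ + u₃ + u₄ + u₅ = v₁ + v₂ + v₃) :
    3 * ((u₁ ^ 4 + u₂ ^ 4 + u₃ ^ 4 + u₄ ^ 4 + u₅ ^ 4) - (v₁ ^ 4 + v₂ ^ 4 + v₃ ^ 4)) - (3 / 2) * ((u₁ ^ 2 + u₂ ^ 2 + u₃ ^ 2 + u₄ ^ 2 + u₅ ^ 2) - (v₁ ^ 2 + v₂ ^ 2 + v₃ ^ 2)) ^ 2
      = -12 * ((u₂ - v₂) * (u₃ - v₂) * (u₄ - v₂) * (u₅ - v₂)
          + (u₁ - v₁) * (u₃ - v₂) * (u₄ - v₂) * (u₅ - v₂)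
          + (u₁ - v₁) * (u₂ - v₁) * (u₄ - v₂) * (u₅ - v₂)
          + (u₁ - v₁) * (u₂ - v₁) * (u₃ - v₁) * (u₅ - v₂)
          + (u₁ - v₁) * (u₂ - v₁) * (u₃ - v₁) * (u₄ - v₁))
        + 4 * v₃ * ((u₁ ^ 3 + u₂ ^ 3 + u₃ ^ 3 + u₄ ^ 3 + u₅ ^ 3) - (v₁ ^ 3 + v₂ ^ 3 + v₃ ^ 3)) := by
  have hv : v₃ = u₁ + u₂ + u₃ + u₄ + u₅ - v₁ - v₂ := by linarith
  subst hv
  ring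

/-- DIVIDED-DIFFERENCE PRODUCT FORMULA for `Q₂` (format (5,3)), relative to the F-roots `1, 2`:
`Q₂ = 2·[y²]M₁₂ − 2·v₃·P1 − 2·B₃·P2` (centred positions and charges). -/
theorem Q2_eq_dd12 (A₁ A₂ A₃ A₄ A₅ B₁ B₂ B₃ u₁ u₂ u₃ u₄ u₅ v₁ v₂ v₃ : ℝ)
    (hA : A₁ + A₂ + A₃ + A₄ + A₅ = B₁ + B₂ + B₃) (hC : u₁ + u₂ + u₃ + u₄ + u₅ = v₁ + v₂ + v₃) :
    (1 / 2) * ((A₁ ^ 2 + A₂ ^ 2 + A₃ ^ 2 + A₄ ^ 2 + A₅ ^ 2) - (B₁ ^ 2 + B₂ ^ 2 + B₃ ^ 2)) * ((u₁ ^ 2 + u₂ ^ 2 + u₃ ^ 2 + u₄ ^ 2 + u₅ ^ 2) - (v₁ ^ 2 + v₂ ^ 2 + v₃ ^ 2))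
        + ((A₁ * u₁ + A₂ * u₂ + A₃ * u₃ + A₄ * u₄ + A₅ * u₅) - (B₁ * v₁ + B₂ * v₂ + B₃ * v₃)) ^ 2
        - 3 * ((A₁ ^ 2 * u₁ ^ 2 + A₂ ^ 2 * u₂ ^ 2 + A₃ ^ 2 * u₃ ^ 2 + A₄ ^ 2 * u₄ ^ 2 + A₅ ^ 2 * u₅ ^ 2) - (B₁ ^ 2 * v₁ ^ 2 + B₂ ^ 2 * v₂ ^ 2 + B₃ ^ 2 * v₃ ^ 2))
      = 2 * ((A₂ - B₂) * (A₃ - B₂) * (u₄ - v₂) * (u₅ - v₂)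
          + (A₂ - B₂) * (u₃ - v₂) * (A₄ - B₂) * (u₅ - v₂)
          + (A₂ - B₂) * (u₃ - v₂) * (u₄ - v₂) * (A₅ - B₂)
          + (u₂ - v₂) * (A₃ - B₂) * (A₄ - B₂) * (u₅ - v₂)
          + (u₂ - v₂) * (A₃ - B₂) * (u₄ - v₂) * (A₅ - B₂)
          + (u₂ - v₂) * (u₃ - v₂) * (A₄ - B₂) * (A₅ - B₂)
          + (A₁ - B₁) * (A₃ - B₂) * (u₄ - v₂) * (u₅ - v₂)
          + (A₁ - B₁) * (u₃ - v₂) * (A₄ - B₂) * (u₅ - v₂)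
          + (A₁ - B₁) * (u₃ - v₂) * (u₄ - v₂) * (A₅ - B₂)
          + (u₁ - v₁) * (A₃ - B₂) * (A₄ - B₂) * (u₅ - v₂)
          + (u₁ - v₁) * (A₃ - B₂) * (u₄ - v₂) * (A₅ - B₂)
          + (u₁ - v₁) * (u₃ - v₂) * (A₄ - B₂) * (A₅ - B₂)
          + (A₁ - B₁) * (A₂ - B₁) * (u₄ - v₂) * (u₅ - v₂)
          + (A₁ - B₁) * (u₂ - v₁) * (A₄ - B₂) * (u₅ - v₂)
          + (A₁ - B₁) * (u₂ - v₁) * (u₄ - v₂) * (A₅ - B₂)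
          + (u₁ - v₁) * (A₂ - B₁) * (A₄ - B₂) * (u₅ - v₂)
          + (u₁ - v₁) * (A₂ - B₁) * (u₄ - v₂) * (A₅ - B₂)
          + (u₁ - v₁) * (u₂ - v₁) * (A₄ - B₂) * (A₅ - B₂)
          + (A₁ - B₁) * (A₂ - B₁) * (u₃ - v₁) * (u₅ - v₂)
          + (A₁ - B₁) * (u₂ - v₁) * (A₃ - B₁) * (u₅ - v₂)
          + (A₁ - B₁) * (u₂ - v₁) * (u₃ - v₁) * (A₅ - B₂)
          + (u₁ - v₁) * (A₂ - B₁) * (A₃ - B₁) * (u₅ - v₂)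
          + (u₁ - v₁) * (A₂ - B₁) * (u₃ - v₁) * (A₅ - B₂)
          + (u₁ - v₁) * (u₂ - v₁) * (A₃ - B₁) * (A₅ - B₂)
          + (A₁ - B₁) * (A₂ - B₁) * (u₃ - v₁) * (u₄ - v₁)
          + (A₁ - B₁) * (u₂ - v₁) * (A₃ - B₁) * (u₄ - v₁)
          + (A₁ - B₁) * (u₂ - v₁) * (u₃ - v₁) * (A₄ - B₁)
          + (u₁ - v₁) * (A₂ - B₁) * (A₃ - B₁) * (u₄ - v₁)
          + (u₁ - v₁) * (A₂ - B₁) * (u₃ - v₁) * (A₄ - B₁)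
          + (u₁ - v₁) * (u₂ - v₁) * (A₃ - B₁) * (A₄ - B₁))
        - 2 * v₃ * ((A₁ ^ 2 * u₁ + A₂ ^ 2 * u₂ + A₃ ^ 2 * u₃ + A₄ ^ 2 * u₄ + A₅ ^ 2 * u₅) - (B₁ ^ 2 * v₁ + B₂ ^ 2 * v₂ + B₃ ^ 2 * v₃))
        - 2 * B₃ * ((A₁ * u₁ ^ 2 + A₂ * u₂ ^ 2 + A₃ * u₃ ^ 2 + A₄ * u₄ ^ 2 + A₅ * u₅ ^ 2) - (B₁ * v₁ ^ 2 + B₂ * v₂ ^ 2 + B₃ * v₃ ^ 2)) := by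
  have hB : B₃ = A₁ + A₂ + A₃ + A₄ + A₅ - B₁ - B₂ := by linarith
  have hv : v₃ = u₁ + u₂ + u₃ + u₄ + u₅ - v₁ - v₂ := by linarith
  subst hB; subst hv
  ring

/-- The first-order coefficient: `c₁ := 12·Σε u³A − 6·S_u·S_{Au} = −12·[y¹]M₁₂ + 12·v₃·P2 + 4·B₃·P4` (format (5,3)). -/
theorem c1_eq_dd12 (A₁ A₂ A₃ A₄ A₅ B₁ B₂ B₃ u₁ u₂ u₃ u₄ u₅ v₁ v₂ v₃ : ℝ)
    (hA : A₁ + A₂ + A₃ + A₄ + A₅ = B₁ + B₂ + B₃) (hC : u₁ + u₂ + u₃ + u₄ + u₅ = v₁ + v₂ + v₃) :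
    12 * ((u₁ ^ 3 * A₁ + u₂ ^ 3 * A₂ + u₃ ^ 3 * A₃ + u₄ ^ 3 * A₄ + u₅ ^ 3 * A₅) - (v₁ ^ 3 * B₁ + v₂ ^ 3 * B₂ + v₃ ^ 3 * B₃)) - 6 * ((u₁ ^ 2 + u₂ ^ 2 + u₃ ^ 2 + u₄ ^ 2 + u₅ ^ 2) - (v₁ ^ 2 + v₂ ^ 2 + v₃ ^ 2)) * ((A₁ * u₁ + A₂ * u₂ + A₃ * u₃ + A₄ * u₄ + A₅ * u₅) - (B₁ * v₁ + B₂ * v₂ + B₃ * v₃))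
      = -12 * ((A₂ - B₂) * (u₃ - v₂) * (u₄ - v₂) * (u₅ - v₂)
          + (u₂ - v₂) * (A₃ - B₂) * (u₄ - v₂) * (u₅ - v₂)
          + (u₂ - v₂) * (u₃ - v₂) * (A₄ - B₂) * (u₅ - v₂)
          + (u₂ - v₂) * (u₃ - v₂) * (u₄ - v₂) * (A₅ - B₂)
          + (A₁ - B₁) * (u₃ - v₂) * (u₄ - v₂) * (u₅ - v₂)
          + (u₁ - v₁) * (A₃ - B₂) * (u₄ - v₂) * (u₅ - v₂)
          + (u₁ - v₁) * (u₃ - v₂) * (A₄ - B₂) * (u₅ - v₂)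
          + (u₁ - v₁) * (u₃ - v₂) * (u₄ - v₂) * (A₅ - B₂)
          + (A₁ - B₁) * (u₂ - v₁) * (u₄ - v₂) * (u₅ - v₂)
          + (u₁ - v₁) * (A₂ - B₁) * (u₄ - v₂) * (u₅ - v₂)
          + (u₁ - v₁) * (u₂ - v₁) * (A₄ - B₂) * (u₅ - v₂)
          + (u₁ - v₁) * (u₂ - v₁) * (u₄ - v₂) * (A₅ - B₂)
          + (A₁ - B₁) * (u₂ - v₁) * (u₃ - v₁) * (u₅ - v₂)
          + (u₁ - v₁) * (A₂ - B₁) * (u₃ - v₁) * (u₅ - v₂)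
          + (u₁ - v₁) * (u₂ - v₁) * (A₃ - B₁) * (u₅ - v₂)
          + (u₁ - v₁) * (u₂ - v₁) * (u₃ - v₁) * (A₅ - B₂)
          + (A₁ - B₁) * (u₂ - v₁) * (u₃ - v₁) * (u₄ - v₁)
          + (u₁ - v₁) * (A₂ - B₁) * (u₃ - v₁) * (u₄ - v₁)
          + (u₁ - v₁) * (u₂ - v₁) * (A₃ - B₁) * (u₄ - v₁)
          + (u₁ - v₁) * (u₂ - v₁) * (u₃ - v₁) * (A₄ - B₁))
        + 12 * v₃ * ((A₁ * u₁ ^ 2 + A₂ * u₂ ^ 2 + A₃ * u₃ ^ 2 + A₄ * u₄ ^ 2 + A₅ * u₅ ^ 2) - (B₁ * v₁ ^ 2 + B₂ * v₂ ^ 2 + B₃ * v₃ ^ 2))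
        + 4 * B₃ * ((u₁ ^ 3 + u₂ ^ 3 + u₃ ^ 3 + u₄ ^ 3 + u₅ ^ 3) - (v₁ ^ 3 + v₂ ^ 3 + v₃ ^ 3)) := by
  have hB : B₃ = A₁ + A₂ + A₃ + A₄ + A₅ - B₁ - B₂ := by linarith
  have hv : v₃ = u₁ + u₂ + u₃ + u₄ + u₅ - v₁ - v₂ := by linarith
  subst hB; subst hv
  ring

/-- `G_λ` ON THE PURE LOCUS (format (5,3)): `Q₂ + λ·Q₄ = 2·([y²]M₁₂ − 6λ·[y⁰]M₁₂)`. -/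
theorem Glam_eq_dd12 (A₁ A₂ A₃ A₄ A₅ B₁ B₂ B₃ u₁ u₂ u₃ u₄ u₅ v₁ v₂ v₃ : ℝ)
    (hA : A₁ + A₂ + A₃ + A₄ + A₅ = B₁ + B₂ + B₃) (hC : u₁ + u₂ + u₃ + u₄ + u₅ = v₁ + v₂ + v₃)
    (hP1 : (A₁ ^ 2 * u₁ + A₂ ^ 2 * u₂ + A₃ ^ 2 * u₃ + A₄ ^ 2 * u₄ + A₅ ^ 2 * u₅) - (B₁ ^ 2 * v₁ + B₂ ^ 2 * v₂ + B₃ ^ 2 * v₃) = 0)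
    (hP2 : (A₁ * u₁ ^ 2 + A₂ * u₂ ^ 2 + A₃ * u₃ ^ 2 + A₄ * u₄ ^ 2 + A₅ * u₅ ^ 2) - (B₁ * v₁ ^ 2 + B₂ * v₂ ^ 2 + B₃ * v₃ ^ 2) = 0)
    (hP4 : (u₁ ^ 3 + u₂ ^ 3 + u₃ ^ 3 + u₄ ^ 3 + u₅ ^ 3) - (v₁ ^ 3 + v₂ ^ 3 + v₃ ^ 3) = 0)
    (l : ℝ) :
    (1 / 2) * ((A₁ ^ 2 + A₂ ^ 2 + A₃ ^ 2 + A₄ ^ 2 + A₅ ^ 2) - (B₁ ^ 2 + B₂ ^ 2 + B₃ ^ 2)) * ((u₁ ^ 2 + u₂ ^ 2 + u₃ ^ 2 + u₄ ^ 2 + u₅ ^ 2) - (v₁ ^ 2 + v₂ ^ 2 + v₃ ^ 2))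
        + ((A₁ * u₁ + A₂ * u₂ + A₃ * u₃ + A₄ * u₄ + A₅ * u₅) - (B₁ * v₁ + B₂ * v₂ + B₃ * v₃)) ^ 2
        - 3 * ((A₁ ^ 2 * u₁ ^ 2 + A₂ ^ 2 * u₂ ^ 2 + A₃ ^ 2 * u₃ ^ 2 + A₄ ^ 2 * u₄ ^ 2 + A₅ ^ 2 * u₅ ^ 2) - (B₁ ^ 2 * v₁ ^ 2 + B₂ ^ 2 * v₂ ^ 2 + B₃ ^ 2 * v₃ ^ 2))
      + l * (3 * ((u₁ ^ 4 + u₂ ^ 4 + u₃ ^ 4 + u₄ ^ 4 + u₅ ^ 4) - (v₁ ^ 4 + v₂ ^ 4 + v₃ ^ 4)) - (3 / 2) * ((u₁ ^ 2 + u₂ ^ 2 + u₃ ^ 2 + u₄ ^ 2 + u₅ ^ 2) - (v₁ ^ 2 + v₂ ^ 2 + v₃ ^ 2)) ^ 2)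
      = 2 * (((A₂ - B₂) * (A₃ - B₂) * (u₄ - v₂) * (u₅ - v₂)
          + (A₂ - B₂) * (u₃ - v₂) * (A₄ - B₂) * (u₅ - v₂)
          + (A₂ - B₂) * (u₃ - v₂) * (u₄ - v₂) * (A₅ - B₂)
          + (u₂ - v₂) * (A₃ - B₂) * (A₄ - B₂) * (u₅ - v₂)
          + (u₂ - v₂) * (A₃ - B₂) * (u₄ - v₂) * (A₅ - B₂)
          + (u₂ - v₂) * (u₃ - v₂) * (A₄ - B₂) * (A₅ - B₂)
          + (A₁ - B₁) * (A₃ - B₂) * (u₄ - v₂) * (u₅ - v₂)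
          + (A₁ - B₁) * (u₃ - v₂) * (A₄ - B₂) * (u₅ - v₂)
          + (A₁ - B₁) * (u₃ - v₂) * (u₄ - v₂) * (A₅ - B₂)
          + (u₁ - v₁) * (A₃ - B₂) * (A₄ - B₂) * (u₅ - v₂)
          + (u₁ - v₁) * (A₃ - B₂) * (u₄ - v₂) * (A₅ - B₂)
          + (u₁ - v₁) * (u₃ - v₂) * (A₄ - B₂) * (A₅ - B₂)
          + (A₁ - B₁) * (A₂ - B₁) * (u₄ - v₂) * (u₅ - v₂)
          + (A₁ - B₁) * (u₂ - v₁) * (A₄ - B₂) * (u₅ - v₂)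
          + (A₁ - B₁) * (u₂ - v₁) * (u₄ - v₂) * (A₅ - B₂)
          + (u₁ - v₁) * (A₂ - B₁) * (A₄ - B₂) * (u₅ - v₂)
          + (u₁ - v₁) * (A₂ - B₁) * (u₄ - v₂) * (A₅ - B₂)
          + (u₁ - v₁) * (u₂ - v₁) * (A₄ - B₂) * (A₅ - B₂)
          + (A₁ - B₁) * (A₂ - B₁) * (u₃ - v₁) * (u₅ - v₂)
          + (A₁ - B₁) * (u₂ - v₁) * (A₃ - B₁) * (u₅ - v₂)
          + (A₁ - B₁) * (u₂ - v₁) * (u₃ - v₁) * (A₅ - B₂)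
          + (u₁ - v₁) * (A₂ - B₁) * (A₃ - B₁) * (u₅ - v₂)
          + (u₁ - v₁) * (A₂ - B₁) * (u₃ - v₁) * (A₅ - B₂)
          + (u₁ - v₁) * (u₂ - v₁) * (A₃ - B₁) * (A₅ - B₂)
          + (A₁ - B₁) * (A₂ - B₁) * (u₃ - v₁) * (u₄ - v₁)
          + (A₁ - B₁) * (u₂ - v₁) * (A₃ - B₁) * (u₄ - v₁)
          + (A₁ - B₁) * (u₂ - v₁) * (u₃ - v₁) * (A₄ - B₁)
          + (u₁ - v₁) * (A₂ - B₁) * (A₃ - B₁) * (u₄ - v₁)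
          + (u₁ - v₁) * (A₂ - B₁) * (u₃ - v₁) * (A₄ - B₁)
          + (u₁ - v₁) * (u₂ - v₁) * (A₃ - B₁) * (A₄ - B₁))
        - 6 * l * ((u₂ - v₂) * (u₃ - v₂) * (u₄ - v₂) * (u₅ - v₂)
          + (u₁ - v₁) * (u₃ - v₂) * (u₄ - v₂) * (u₅ - v₂)
          + (u₁ - v₁) * (u₂ - v₁) * (u₄ - v₂) * (u₅ - v₂)
          + (u₁ - v₁) * (u₂ - v₁) * (u₃ - v₁) * (u₅ - v₂)
          + (u₁ - v₁) * (u₂ - v₁) * (u₃ - v₁) * (u₄ - v₁))) := by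
  have h2 := Q2_eq_dd12 A₁ A₂ A₃ A₄ A₅ B₁ B₂ B₃ u₁ u₂ u₃ u₄ u₅ v₁ v₂ v₃ hA hC
  have h4 := Q4_eq_dd12 u₁ u₂ u₃ u₄ u₅ v₁ v₂ v₃ hC
  rw [hP1, hP2] at h2
  rw [hP4] at h4
  rw [h2, h4]
  ring

/-- COLLINEARITY of `(v_g, K₀(g))`: `[y⁰]M₁₂ − [y⁰]M₁₃ = ((v₃ − v₂)/3)·P4`, i.e. the second divided difference of `g ↦ K₀(g) = ∏_e(u_e − v_g)`
over the three F-charges is `P4/3` (`= e₃` of the virtual alphabet); on the pure locus `(K₀(g) − K₀(h))/(v_g − v_h) = Q₄/12` for every pair. -/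
theorem dd0_12_sub_13 (u₁ u₂ u₃ u₄ u₅ v₁ v₂ v₃ : ℝ)
    (hC : u₁ + u₂ + u₃ + u₄ + u₅ = v₁ + v₂ + v₃) :
    ((u₂ - v₂) * (u₃ - v₂) * (u₄ - v₂) * (u₅ - v₂)
          + (u₁ - v₁) * (u₃ - v₂) * (u₄ - v₂) * (u₅ - v₂)
          + (u₁ - v₁) * (u₂ - v₁) * (u₄ - v₂) * (u₅ - v₂)
          + (u₁ - v₁) * (u₂ - v₁) * (u₃ - v₁) * (u₅ - v₂)
          + (u₁ - v₁) * (u₂ - v₁) * (u₃ - v₁) * (u₄ - v₁))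
      - ((u₂ - v₃) * (u₃ - v₃) * (u₄ - v₃) * (u₅ - v₃)
          + (u₁ - v₁) * (u₃ - v₃) * (u₄ - v₃) * (u₅ - v₃)
          + (u₁ - v₁) * (u₂ - v₁) * (u₄ - v₃) * (u₅ - v₃)
          + (u₁ - v₁) * (u₂ - v₁) * (u₃ - v₁) * (u₅ - v₃)
          + (u₁ - v₁) * (u₂ - v₁) * (u₃ - v₁) * (u₄ - v₁))
      = ((v₃ - v₂) / 3) * ((u₁ ^ 3 + u₂ ^ 3 + u₃ ^ 3 + u₄ ^ 3 + u₅ ^ 3) - (v₁ ^ 3 + v₂ ^ 3 + v₃ ^ 3)) := by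
  have hv : v₃ = u₁ + u₂ + u₃ + u₄ + u₅ - v₁ - v₂ := by linarith
  subst hv
  ring

/-- First-order companion: `[y¹]M₁₂ − [y¹]M₁₃ = (v₃ − v₂)·P2 + ((B₃ − B₂)/3)·P4`. -/
theorem dd1_12_sub_13 (A₁ A₂ A₃ A₄ A₅ B₁ B₂ B₃ u₁ u₂ u₃ u₄ u₅ v₁ v₂ v₃ : ℝ)
    (hA : A₁ + A₂ + A₃ + A₄ + A₅ = B₁ + B₂ + B₃) (hC : u₁ + u₂ + u₃ + u₄ + u₅ = v₁ + v₂ + v₃) :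
    ((A₂ - B₂) * (u₃ - v₂) * (u₄ - v₂) * (u₅ - v₂)
          + (u₂ - v₂) * (A₃ - B₂) * (u₄ - v₂) * (u₅ - v₂)
          + (u₂ - v₂) * (u₃ - v₂) * (A₄ - B₂) * (u₅ - v₂)
          + (u₂ - v₂) * (u₃ - v₂) * (u₄ - v₂) * (A₅ - B₂)
          + (A₁ - B₁) * (u₃ - v₂) * (u₄ - v₂) * (u₅ - v₂)
          + (u₁ - v₁) * (A₃ - B₂) * (u₄ - v₂) * (u₅ - v₂)
          + (u₁ - v₁) * (u₃ - v₂) * (A₄ - B₂) * (u₅ - v₂)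
          + (u₁ - v₁) * (u₃ - v₂) * (u₄ - v₂) * (A₅ - B₂)
          + (A₁ - B₁) * (u₂ - v₁) * (u₄ - v₂) * (u₅ - v₂)
          + (u₁ - v₁) * (A₂ - B₁) * (u₄ - v₂) * (u₅ - v₂)
          + (u₁ - v₁) * (u₂ - v₁) * (A₄ - B₂) * (u₅ - v₂)
          + (u₁ - v₁) * (u₂ - v₁) * (u₄ - v₂) * (A₅ - B₂)
          + (A₁ - B₁) * (u₂ - v₁) * (u₃ - v₁) * (u₅ - v₂)
          + (u₁ - v₁) * (A₂ - B₁) * (u₃ - v₁) * (u₅ - v₂)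
          + (u₁ - v₁) * (u₂ - v₁) * (A₃ - B₁) * (u₅ - v₂)
          + (u₁ - v₁) * (u₂ - v₁) * (u₃ - v₁) * (A₅ - B₂)
          + (A₁ - B₁) * (u₂ - v₁) * (u₃ - v₁) * (u₄ - v₁)
          + (u₁ - v₁) * (A₂ - B₁) * (u₃ - v₁) * (u₄ - v₁)
          + (u₁ - v₁) * (u₂ - v₁) * (A₃ - B₁) * (u₄ - v₁)
          + (u₁ - v₁) * (u₂ - v₁) * (u₃ - v₁) * (A₄ - B₁))
      - ((A₂ - B₃) * (u₃ - v₃) * (u₄ - v₃) * (u₅ - v₃)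
          + (u₂ - v₃) * (A₃ - B₃) * (u₄ - v₃) * (u₅ - v₃)
          + (u₂ - v₃) * (u₃ - v₃) * (A₄ - B₃) * (u₅ - v₃)
          + (u₂ - v₃) * (u₃ - v₃) * (u₄ - v₃) * (A₅ - B₃)
          + (A₁ - B₁) * (u₃ - v₃) * (u₄ - v₃) * (u₅ - v₃)
          + (u₁ - v₁) * (A₃ - B₃) * (u₄ - v₃) * (u₅ - v₃)
          + (u₁ - v₁) * (u₃ - v₃) * (A₄ - B₃) * (u₅ - v₃)
          + (u₁ - v₁) * (u₃ - v₃) * (u₄ - v₃) * (A₅ - B₃)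
          + (A₁ - B₁) * (u₂ - v₁) * (u₄ - v₃) * (u₅ - v₃)
          + (u₁ - v₁) * (A₂ - B₁) * (u₄ - v₃) * (u₅ - v₃)
          + (u₁ - v₁) * (u₂ - v₁) * (A₄ - B₃) * (u₅ - v₃)
          + (u₁ - v₁) * (u₂ - v₁) * (u₄ - v₃) * (A₅ - B₃)
          + (A₁ - B₁) * (u₂ - v₁) * (u₃ - v₁) * (u₅ - v₃)
          + (u₁ - v₁) * (A₂ - B₁) * (u₃ - v₁) * (u₅ - v₃)
          + (u₁ - v₁) * (u₂ - v₁) * (A₃ - B₁) * (u₅ - v₃)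
          + (u₁ - v₁) * (u₂ - v₁) * (u₃ - v₁) * (A₅ - B₃)
          + (A₁ - B₁) * (u₂ - v₁) * (u₃ - v₁) * (u₄ - v₁)
          + (u₁ - v₁) * (A₂ - B₁) * (u₃ - v₁) * (u₄ - v₁)
          + (u₁ - v₁) * (u₂ - v₁) * (A₃ - B₁) * (u₄ - v₁)
          + (u₁ - v₁) * (u₂ - v₁) * (u₃ - v₁) * (A₄ - B₁))
      = (v₃ - v₂) * ((A₁ * u₁ ^ 2 + A₂ * u₂ ^ 2 + A₃ * u₃ ^ 2 + A₄ * u₄ ^ 2 + A₅ * u₅ ^ 2) - (B₁ * v₁ ^ 2 + B₂ * v₂ ^ 2 + B₃ * v₃ ^ 2)) + ((B₃ - B₂) / 3) * ((u₁ ^ 3 + u₂ ^ 3 + u₃ ^ 3 + u₄ ^ 3 + u₅ ^ 3) - (v₁ ^ 3 + v₂ ^ 3 + v₃ ^ 3)) := by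
  have hB : B₃ = A₁ + A₂ + A₃ + A₄ + A₅ - B₁ - B₂ := by linarith
  have hv : v₃ = u₁ + u₂ + u₃ + u₄ + u₅ - v₁ - v₂ := by linarith
  subst hB; subst hv
  ring

/-- Second-order companion: `[y²]M₁₂ − [y²]M₁₃ = (v₃ − v₂)·P1 + (B₃ − B₂)·P2`. With the two previous lemmas: PURITY (P1 = P2 = P4 = 0)
says that the second divided difference of `g ↦ Π_g(y)` over the three F-roots vanishes to order `y²`. -/
theorem dd2_12_sub_13 (A₁ A₂ A₃ A₄ A₅ B₁ B₂ B₃ u₁ u₂ u₃ u₄ u₅ v₁ v₂ v₃ : ℝ)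
    (hA : A₁ + A₂ + A₃ + A₄ + A₅ = B₁ + B₂ + B₃) (hC : u₁ + u₂ + u₃ + u₄ + u₅ = v₁ + v₂ + v₃) :
    ((A₂ - B₂) * (A₃ - B₂) * (u₄ - v₂) * (u₅ - v₂)
          + (A₂ - B₂) * (u₃ - v₂) * (A₄ - B₂) * (u₅ - v₂)
          + (A₂ - B₂) * (u₃ - v₂) * (u₄ - v₂) * (A₅ - B₂)
          + (u₂ - v₂) * (A₃ - B₂) * (A₄ - B₂) * (u₅ - v₂)
          + (u₂ - v₂) * (A₃ - B₂) * (u₄ - v₂) * (A₅ - B₂)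
          + (u₂ - v₂) * (u₃ - v₂) * (A₄ - B₂) * (A₅ - B₂)
          + (A₁ - B₁) * (A₃ - B₂) * (u₄ - v₂) * (u₅ - v₂)
          + (A₁ - B₁) * (u₃ - v₂) * (A₄ - B₂) * (u₅ - v₂)
          + (A₁ - B₁) * (u₃ - v₂) * (u₄ - v₂) * (A₅ - B₂)
          + (u₁ - v₁) * (A₃ - B₂) * (A₄ - B₂) * (u₅ - v₂)
          + (u₁ - v₁) * (A₃ - B₂) * (u₄ - v₂) * (A₅ - B₂)
          + (u₁ - v₁) * (u₃ - v₂) * (A₄ - B₂) * (A₅ - B₂)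
          + (A₁ - B₁) * (A₂ - B₁) * (u₄ - v₂) * (u₅ - v₂)
          + (A₁ - B₁) * (u₂ - v₁) * (A₄ - B₂) * (u₅ - v₂)
          + (A₁ - B₁) * (u₂ - v₁) * (u₄ - v₂) * (A₅ - B₂)
          + (u₁ - v₁) * (A₂ - B₁) * (A₄ - B₂) * (u₅ - v₂)
          + (u₁ - v₁) * (A₂ - B₁) * (u₄ - v₂) * (A₅ - B₂)
          + (u₁ - v₁) * (u₂ - v₁) * (A₄ - B₂) * (A₅ - B₂)
          + (A₁ - B₁) * (A₂ - B₁) * (u₃ - v₁) * (u₅ - v₂)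
          + (A₁ - B₁) * (u₂ - v₁) * (A₃ - B₁) * (u₅ - v₂)
          + (A₁ - B₁) * (u₂ - v₁) * (u₃ - v₁) * (A₅ - B₂)
          + (u₁ - v₁) * (A₂ - B₁) * (A₃ - B₁) * (u₅ - v₂)
          + (u₁ - v₁) * (A₂ - B₁) * (u₃ - v₁) * (A₅ - B₂)
          + (u₁ - v₁) * (u₂ - v₁) * (A₃ - B₁) * (A₅ - B₂)
          + (A₁ - B₁) * (A₂ - B₁) * (u₃ - v₁) * (u₄ - v₁)
          + (A₁ - B₁) * (u₂ - v₁) * (A₃ - B₁) * (u₄ - v₁)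
          + (A₁ - B₁) * (u₂ - v₁) * (u₃ - v₁) * (A₄ - B₁)
          + (u₁ - v₁) * (A₂ - B₁) * (A₃ - B₁) * (u₄ - v₁)
          + (u₁ - v₁) * (A₂ - B₁) * (u₃ - v₁) * (A₄ - B₁)
          + (u₁ - v₁) * (u₂ - v₁) * (A₃ - B₁) * (A₄ - B₁))
      - ((A₂ - B₃) * (A₃ - B₃) * (u₄ - v₃) * (u₅ - v₃)
          + (A₂ - B₃) * (u₃ - v₃) * (A₄ - B₃) * (u₅ - v₃)
          + (A₂ - B₃) * (u₃ - v₃) * (u₄ - v₃) * (A₅ - B₃)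
          + (u₂ - v₃) * (A₃ - B₃) * (A₄ - B₃) * (u₅ - v₃)
          + (u₂ - v₃) * (A₃ - B₃) * (u₄ - v₃) * (A₅ - B₃)
          + (u₂ - v₃) * (u₃ - v₃) * (A₄ - B₃) * (A₅ - B₃)
          + (A₁ - B₁) * (A₃ - B₃) * (u₄ - v₃) * (u₅ - v₃)
          + (A₁ - B₁) * (u₃ - v₃) * (A₄ - B₃) * (u₅ - v₃)
          + (A₁ - B₁) * (u₃ - v₃) * (u₄ - v₃) * (A₅ - B₃)
          + (u₁ - v₁) * (A₃ - B₃) * (A₄ - B₃) * (u₅ - v₃)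
          + (u₁ - v₁) * (A₃ - B₃) * (u₄ - v₃) * (A₅ - B₃)
          + (u₁ - v₁) * (u₃ - v₃) * (A₄ - B₃) * (A₅ - B₃)
          + (A₁ - B₁) * (A₂ - B₁) * (u₄ - v₃) * (u₅ - v₃)
          + (A₁ - B₁) * (u₂ - v₁) * (A₄ - B₃) * (u₅ - v₃)
          + (A₁ - B₁) * (u₂ - v₁) * (u₄ - v₃) * (A₅ - B₃)
          + (u₁ - v₁) * (A₂ - B₁) * (A₄ - B₃) * (u₅ - v₃)
          + (u₁ - v₁) * (A₂ - B₁) * (u₄ - v₃) * (A₅ - B₃)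
          + (u₁ - v₁) * (u₂ - v₁) * (A₄ - B₃) * (A₅ - B₃)
          + (A₁ - B₁) * (A₂ - B₁) * (u₃ - v₁) * (u₅ - v₃)
          + (A₁ - B₁) * (u₂ - v₁) * (A₃ - B₁) * (u₅ - v₃)
          + (A₁ - B₁) * (u₂ - v₁) * (u₃ - v₁) * (A₅ - B₃)
          + (u₁ - v₁) * (A₂ - B₁) * (A₃ - B₁) * (u₅ - v₃)
          + (u₁ - v₁) * (A₂ - B₁) * (u₃ - v₁) * (A₅ - B₃)
          + (u₁ - v₁) * (u₂ - v₁) * (A₃ - B₁) * (A₅ - B₃)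
          + (A₁ - B₁) * (A₂ - B₁) * (u₃ - v₁) * (u₄ - v₁)
          + (A₁ - B₁) * (u₂ - v₁) * (A₃ - B₁) * (u₄ - v₁)
          + (A₁ - B₁) * (u₂ - v₁) * (u₃ - v₁) * (A₄ - B₁)
          + (u₁ - v₁) * (A₂ - B₁) * (A₃ - B₁) * (u₄ - v₁)
          + (u₁ - v₁) * (A₂ - B₁) * (u₃ - v₁) * (A₄ - B₁)
          + (u₁ - v₁) * (u₂ - v₁) * (A₃ - B₁) * (A₄ - B₁))
      = (v₃ - v₂) * ((A₁ ^ 2 * u₁ + A₂ ^ 2 * u₂ + A₃ ^ 2 * u₃ + A₄ ^ 2 * u₄ + A₅ ^ 2 * u₅) - (B₁ ^ 2 * v₁ + B₂ ^ 2 * v₂ + B₃ ^ 2 * v₃)) + (B₃ - B₂) * ((A₁ * u₁ ^ 2 + A₂ * u₂ ^ 2 + A₃ * u₃ ^ 2 + A₄ * u₄ ^ 2 + A₅ * u₅ ^ 2) - (B₁ * v₁ ^ 2 + B₂ * v₂ ^ 2 + B₃ * v₃ ^ 2)) := by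
  have hB : B₃ = A₁ + A₂ + A₃ + A₄ + A₅ - B₁ - B₂ := by linarith
  have hv : v₃ = u₁ + u₂ + u₃ + u₄ + u₅ - v₁ - v₂ := by linarith
  subst hB; subst hv
  ring

end Summit.HodgeConjecture.HodgeConjecture.WeilClassTestFormatFiveThreeProductFormula
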